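import Summits.SmoothPoincare4.SmoothPoincare4.Theorems.CylinderEntropyCylinderRungTwoKernelMassOfProduct
import Summits.SmoothPoincare4.SmoothPoincare4.Theorems.CylinderEntropyCylinderRungTwoFluxIdentityPushOff
import HarnessLib

/-!
# Route `CylinderEntropy`, crux `CylinderRungTwo` (stmt-SmoothPoincare4-7631), line `killing-flux`:
# a product measure carried by one slice is the uniform slice measure
# (registered helper `helper_productLimitOnSlice`; lead c4, "relaxation up to multiplicity", worker A5a)

Weak limits `μ` of the area measures of thin cylinder flows are finite measures on `ℝ⁶` with PRODUCT
structure: against products of continuous test functions `Φ(z₅) g(z')` (`z' = truncL z ∈ ℝ⁵` the first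
five coordinates) they are uniform in the `S⁴` factor,

  `∫ Φ(z₅) g(z') dμ = μH⁴(S⁴)⁻¹ (∫_{S⁴} g dμH⁴) ∫ Φ(z₅) dμ`.

Lead c4 shows that the heights of the flow converge to a single value `c`, so that such a limit `μ` is
carried by the slice `{z₅ = c}`.  This file identifies `μ` completely in that situation: against every
bounded continuous `g : ℝ⁶ → ℝ`,

  `∫ g dμ = μH⁴(S⁴)⁻¹ · μ(ℝ⁶) · ∫_{S⁴} g(y, c) dμH⁴(y)`,

i.e. `μ = (μ(ℝ⁶) / μH⁴(S⁴)) · (uniform measure of the slice at height c)`.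

Proof.  On the carrier `{z₅ = c}` one has `z = (z', z₅) = padL (truncL z) + c • e₅` (the vertical
decomposition `eq_vert` of `ℝ⁶ = ℝ⁵ × ℝ`), so `g z = G (truncL z)` for `μ`-a.e. `z`, where
`G q := g (padL q + c • e₅)` is continuous.  Hence `∫ g dμ = ∫ 1 · G(z') dμ`, and the product hypothesis
with `Φ ≡ 1` gives `μH⁴(S⁴)⁻¹ (∫_{S⁴} G dμH⁴) ∫ 1 dμ`, with `∫ 1 dμ = μ.real univ`.  The bound `B` and the
slab-carrier hypothesis of the registered signature are not used.

Everything here is PROVED (no `sorry`, no definitions, no named facts).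

References: H. Federer, *Geometric Measure Theory* (1969), 2.10.45 (product measures) — folklore.
-/

-- the prescribed namespace `Summit.SmoothPoincare4.SmoothPoincare4.…` repeats `SmoothPoincare4`
set_option linter.dupNamespace false

noncomputable section

open Bundle Set Function Filter MeasureTheory Module
open scoped Manifold ContDiff Topology RealInnerProductSpace BigOperators ENNReal NNReal

namespace Summit.SmoothPoincare4.SmoothPoincare4.Cruxes.CylinderRungTwo.KillingFlux

open Literature.Geometry.Riemannian
open Literature.Geometry.Riemannian.SphericalCylinderEntropy (truncL truncL_apply)
open Literature.Geometry.Manifold.CylinderSlice (padL axis)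
open Summit.SmoothPoincare4.SmoothPoincare4.Theorems.CylinderRungTwo.KillingFlux (eq_vert)

namespace ProductLimitOnSlice

/-- The slice test function `q ↦ g (q, c)` of a bounded continuous `g : ℝ⁶ → ℝ` is continuous on `ℝ⁵`
(`padL` is a continuous linear map). [folklore] -/
theorem continuous_sliceTest (g : BoundedContinuousFunction (EuclideanSpace ℝ (Fin 6)) ℝ) (c : ℝ) :
    Continuous fun q : EuclideanSpace ℝ (Fin 5) => g (padL q + c • axis) :=
  g.continuous.comp (padL.continuous.add continuous_const)

/-- On a measure carried by the slice `{z₅ = c}`, every function `g` of `z ∈ ℝ⁶` agrees a.e. with the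
function `g (z', c)` of its first five coordinates `z' = truncL z` (vertical decomposition
`z = padL (truncL z) + z₅ • e₅`). [folklore] -/
theorem ae_eq_sliceTest_truncL (μ : Measure (EuclideanSpace ℝ (Fin 6))) (c : ℝ)
    (hc : μ {z : EuclideanSpace ℝ (Fin 6) | z 5 ≠ c} = 0) (g : EuclideanSpace ℝ (Fin 6) → ℝ) :
    (fun z => g z) =ᵐ[μ] fun z => g (padL (truncL z) + c • axis) := by
  have hz : ∀ᵐ z ∂μ, z 5 = c := ae_iff.2 hc
  filter_upwards [hz] with z hz
  rw [← hz, ← eq_vert z]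

end ProductLimitOnSlice

open ProductLimitOnSlice

/-- **Registered helper `helper_productLimitOnSlice` of line `killing-flux` (lead c4, relaxation up to
multiplicity, A5a).**  A finite measure `μ` on `ℝ⁶` which is uniform in the `S⁴` factor against continuous
product tests `Φ(z₅) g(z')` and which is carried by one slice `{z₅ = c}` is the uniform measure of that
slice with total mass `μ(ℝ⁶)`: against every bounded continuous `g`,
`∫ g dμ = μH⁴(S⁴)⁻¹ · μ.real univ · ∫_{S⁴} g(y, c) dμH⁴(y)`.  (On the carrier `g z = G(z')` with
`G = g(·, c)` continuous; apply the product hypothesis with `Φ ≡ 1`, and `∫ 1 dμ = μ.real univ`.)  The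
bound `B` and the slab-carrier hypothesis are not used. [folklore] -/
theorem helper_productLimitOnSlice : ∀ (μ : Measure (EuclideanSpace ℝ (Fin 6))) [IsFiniteMeasure μ] (B c : ℝ), μ {z : EuclideanSpace ℝ (Fin 6) | ¬ (∑ i : Fin 5, z (Fin.castSucc i) ^ 2 = 1 ∧ |z 5| ≤ B)} = 0 → (∀ Φ : ℝ → ℝ, Continuous Φ → ∀ g : EuclideanSpace ℝ (Fin 5) → ℝ, Continuous g → ∫ z, Φ (z 5) * g (Literature.Geometry.Riemannian.SphericalCylinderEntropy.truncL z) ∂μ = ((μH[4] (Metric.sphere (0 : EuclideanSpace ℝ (Fin 5)) 1)).toReal)⁻¹ * (∫ y in Metric.sphere (0 : EuclideanSpace ℝ (Fin 5)) 1, g y ∂(μH[4] : Measure (EuclideanSpace ℝ (Fin 5)))) * ∫ z, Φ (z 5) ∂μ) → μ {z : EuclideanSpace ℝ (Fin 6) | z 5 ≠ c} = 0 → ∀ g : BoundedContinuousFunction (EuclideanSpace ℝ (Fin 6)) ℝ, ∫ z, g z ∂μ = ((μH[4] (Metric.sphere (0 : EuclideanSpace ℝ (Fin 5)) 1)).toReal)⁻¹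 * μ.real Set.univ * ∫ y in Metric.sphere (0 : EuclideanSpace ℝ (Fin 5)) 1, g (Literature.Geometry.Manifold.CylinderSlice.padL y + c • Literature.Geometry.Manifold.CylinderSlice.axis) ∂(μH[4] : Measure (EuclideanSpace ℝ (Fin 5))) := by
  intro μ _ _ c _ hprod hc g
  have h := hprod (fun _ => (1 : ℝ)) continuous_const _ (continuous_sliceTest g c)
  simp only [one_mul] at h
  rw [integral_congr_ae (ae_eq_sliceTest_truncL μ c hc g), h, integral_const, smul_eq_mul, mul_one]
  ring

end Summit.SmoothPoincare4.SmoothPoincare4.Cruxes.CylinderRungTwo.KillingFlux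

end
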